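import Summits.AtomisticToContinuum.HydrodynamicLimit.Theorems.ImplosionDichotomyPolynomialCompressionUniquenessPrimitive
import Mathlib.Analysis.SpecialFunctions.Pow.Deriv

/-!
# Isentropic reference calculus: `c₁ = ρ₁^{1/3}`, `ρ₁ = c₁³`, `θ₁ = K c₁²`

Helper file for the line `log-lipschitz-budget` of the crux `ImplosionDichotomy.PolynomialCompression`
(stmt-AtomisticToContinuum-12587), stub `stub_logBudgetShadowing`. The `σ = 0` reference of
`stub_typeOneImplosion` is isentropic, `θ₁ = K ρ₁^{2/3}`, and its Type-I bound is typed for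
`∂ᵢ(ρ₁^{1/3})`. Every downstream estimate is POLYNOMIAL in the cube root `c₁ := ρ₁^{1/3}`
(the `γ = 5/3` "miracle": `√θ₁ = √K c₁`, so `∇θ₁/√θ₁`, `√θ₁ ∇log ρ₁`, `∇√θ₁` are all Type I): this
file converts once and for all (`c₁` jointly smooth; `ρ₁ = c₁³`, `θ₁ = Kc₁²`, `√θ₁ = √K c₁`;
`∂ᵢρ₁ = 3c₁²∂ᵢc₁`, `∂ᵢθ₁ = 2Kc₁∂ᵢc₁`; the `σ = 0` pressure law `ρθ·1`; transfer of the Type-I bound).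
-/

noncomputable section

namespace Summit.AtomisticToContinuum.HydrodynamicLimit.Theorems

open Set Filter Topology MeasureTheory
open scoped ContDiff
open Literature.MathematicalPhysics.KineticTheory Literature.Analysis.FunctionSpaces

/-- The ideal-gas (`σ = 0`) pressure law is `ρ θ · 1` (`hsCompressibility 0 = 1`), written in the
`ρ θ ζ(ρ)` shape of the difference-system lemmas with `ζ ≡ 1`. [folklore] -/
theorem hsPressure_zero_eq_ideal : ∀ (ρ θ : ℝ), hsPressure 0 ρ θ = ρ * θ * (fun _ : ℝ => (1 : ℝ)) ρ := by
  intro ρ θ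
  simp [hsPressure, hsCompressibility]

/-- The cube root of the density of a classical solution is jointly smooth on `[0, T) × 𝕋³`
(`ρ > 0`). [folklore] -/
theorem isentropic_cuberoot_smooth :
    ∀ {σ T : ℝ} {ρ θ : ℝ → T3 → ℝ} {u : ℝ → T3 → V3}, IsHardSphereEulerSolution σ T ρ u θ →
      Torus.IsSmoothSpaceTimeOn (Ico 0 T) (fun t x => ρ t x ^ (1 / 3 : ℝ)) := by
  intro σ T ρ θ u hE
  have h : ContDiffOn ℝ ∞ (fun p : ℝ × EuclideanSpace ℝ (Fin 3) => Torus.stLift ρ p ^ (1 / 3 : ℝ))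
      (Ico 0 T ×ˢ univ) := by
    refine hE.smooth_density.rpow_const_of_ne fun p hp => ?_
    rw [Torus.stLift_apply]
    exact (hE.density_pos p.1 (mem_prod.1 hp).1 _).ne'
  exact h

/-- Pointwise algebra of an isentropic state: with `c = ρ^{1/3} > 0`, `ρ = c³`, `θ = K ρ^{2/3} = K c²`
and `√θ = √K c`. [folklore] -/
theorem isentropic_pointwise_algebra :
    ∀ {K r ϑ : ℝ}, 0 < K → 0 < r → ϑ = K * r ^ (2 / 3 : ℝ) →
      0 < r ^ (1 / 3 : ℝ) ∧ r = (r ^ (1 / 3 : ℝ)) ^ 3 ∧ ϑ = K * (r ^ (1 / 3 : ℝ)) ^ 2 ∧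
        Real.sqrt ϑ = Real.sqrt K * r ^ (1 / 3 : ℝ) := by
  intro K r ϑ hK hr hϑ
  have hc : 0 < r ^ (1 / 3 : ℝ) := Real.rpow_pos_of_pos hr _
  have h3 : (r ^ (1 / 3 : ℝ)) ^ 3 = r := by
    rw [← Real.rpow_natCast, ← Real.rpow_mul hr.le]; norm_num
  have h2 : (r ^ (1 / 3 : ℝ)) ^ 2 = r ^ (2 / 3 : ℝ) := by
    rw [← Real.rpow_natCast, ← Real.rpow_mul hr.le]; norm_num
  refine ⟨hc, h3.symm, by rw [h2, hϑ], ?_⟩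
  rw [hϑ, ← h2, Real.sqrt_mul hK.le, Real.sqrt_sq hc.le]

/-- **`∂ᵢρ = 3 c² ∂ᵢc`** for the cube root `c = ρ^{1/3}` of the (positive, smooth) density slice of a
classical solution. [folklore] -/
theorem isentropic_partialDeriv_density :
    ∀ {σ T : ℝ} {ρ θ : ℝ → T3 → ℝ} {u : ℝ → T3 → V3}, IsHardSphereEulerSolution σ T ρ u θ →
      ∀ {t : ℝ}, t ∈ Ico 0 T → ∀ (x : T3) (i : Fin 3),
        Torus.partialDeriv i (ρ t) x =
          3 * (ρ t x ^ (1 / 3 : ℝ)) ^ 2 * Torus.partialDeriv i (fun y => ρ t y ^ (1 / 3 : ℝ)) x := by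
  intro σ T ρ θ u hE t ht x i
  have hc1 : Torus.IsContDiff 1 (fun y => ρ t y ^ (1 / 3 : ℝ)) :=
    ((isentropic_cuberoot_smooth hE).isSmooth_slice ht).isContDiff (by simp)
  have hfun : ρ t = fun y => (ρ t y ^ (1 / 3 : ℝ)) ^ 3 := by
    funext y
    have hr : 0 < ρ t y := hE.density_pos t ht y
    rw [← Real.rpow_natCast, ← Real.rpow_mul hr.le]; norm_num
  have hd := (hasDerivAt_coordLine hc1 x i).pow 3
  have hd' : HasDerivAt (fun s : ℝ => ρ t (x + Torus.proj (s • EuclideanSpace.single i (1 : ℝ))))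
      (↑(3 : ℕ) * (ρ t (x + Torus.proj ((0 : ℝ) • EuclideanSpace.single i (1 : ℝ))) ^ (1 / 3 : ℝ)) ^ (3 - 1) *
        Torus.partialDeriv i (fun y => ρ t y ^ (1 / 3 : ℝ)) x) 0 := by
    refine hd.congr_of_eventuallyEq (Eventually.of_forall fun s => ?_)
    exact congrFun hfun _
  rw [partialDeriv_eq_of_hasDerivAt hd']
  simp only [zero_smul, Torus.proj_zero, add_zero]
  norm_num

/-- **`∂ᵢθ = 2 K c ∂ᵢc`** for an isentropic state `θ = K ρ^{2/3}` of a classical solution, `c = ρ^{1/3}`.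
[folklore] -/
theorem isentropic_partialDeriv_temperature :
    ∀ {σ T K : ℝ} {ρ θ : ℝ → T3 → ℝ} {u : ℝ → T3 → V3}, IsHardSphereEulerSolution σ T ρ u θ → 0 < K →
      (∀ t ∈ Ico 0 T, ∀ x, θ t x = K * ρ t x ^ (2 / 3 : ℝ)) →
      ∀ {t : ℝ}, t ∈ Ico 0 T → ∀ (x : T3) (i : Fin 3),
        Torus.partialDeriv i (θ t) x =
          2 * K * ρ t x ^ (1 / 3 : ℝ) * Torus.partialDeriv i (fun y => ρ t y ^ (1 / 3 : ℝ)) x := by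
  intro σ T K ρ θ u hE hK hisen t ht x i
  have hc1 : Torus.IsContDiff 1 (fun y => ρ t y ^ (1 / 3 : ℝ)) :=
    ((isentropic_cuberoot_smooth hE).isSmooth_slice ht).isContDiff (by simp)
  have hfun : θ t = fun y => K * (ρ t y ^ (1 / 3 : ℝ)) ^ 2 := by
    funext y
    have hr : 0 < ρ t y := hE.density_pos t ht y
    exact (isentropic_pointwise_algebra hK hr (hisen t ht y)).2.2.1
  have hd := ((hasDerivAt_coordLine hc1 x i).pow 2).const_mul K
  have hd' : HasDerivAt (fun s : ℝ => θ t (x + Torus.proj (s • EuclideanSpace.single i (1 : ℝ))))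
      (K * (↑(2 : ℕ) * (ρ t (x + Torus.proj ((0 : ℝ) • EuclideanSpace.single i (1 : ℝ))) ^ (1 / 3 : ℝ)) ^ (2 - 1) *
        Torus.partialDeriv i (fun y => ρ t y ^ (1 / 3 : ℝ)) x)) 0 := by
    refine hd.congr_of_eventuallyEq (Eventually.of_forall fun s => ?_)
    exact congrFun hfun _
  rw [partialDeriv_eq_of_hasDerivAt hd']
  simp only [zero_smul, Torus.proj_zero, add_zero]
  norm_num
  ring

/-- **Transfer of the Type-I bound** from `∂ᵢ(ρ^{1/3})` to `∂ᵢρ` and `∂ᵢθ` for an isentropic classical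
solution: `|∂ᵢρ| ≤ 3c²·C/(T₁−t)`, `|∂ᵢθ| ≤ 2Kc·C/(T₁−t)`, `c = ρ^{1/3}`. [folklore] -/
theorem isentropic_typeI_transfer :
    ∀ {σ T K T₁ C : ℝ} {ρ θ : ℝ → T3 → ℝ} {u : ℝ → T3 → V3}, IsHardSphereEulerSolution σ T ρ u θ → 0 < K →
      (∀ t ∈ Ico 0 T, ∀ x, θ t x = K * ρ t x ^ (2 / 3 : ℝ)) →
      ∀ {t : ℝ}, t ∈ Ico 0 T → ∀ (x : T3) (i : Fin 3),
        |Torus.partialDeriv i (fun y => ρ t y ^ (1 / 3 : ℝ)) x| ≤ C / (T₁ - t) →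
        |Torus.partialDeriv i (ρ t) x| ≤ 3 * (ρ t x ^ (1 / 3 : ℝ)) ^ 2 * (C / (T₁ - t)) ∧
        |Torus.partialDeriv i (θ t) x| ≤ 2 * K * ρ t x ^ (1 / 3 : ℝ) * (C / (T₁ - t)) := by
  intro σ T K T₁ C ρ θ u hE hK hisen t ht x i hTI
  have hc : 0 < ρ t x ^ (1 / 3 : ℝ) := Real.rpow_pos_of_pos (hE.density_pos t ht x) _
  rw [isentropic_partialDeriv_density hE ht x i, isentropic_partialDeriv_temperature hE hK hisen ht x i,
    abs_mul (3 * (ρ t x ^ (1 / 3 : ℝ)) ^ 2) (Torus.partialDeriv i (fun y => ρ t y ^ (1 / 3 : ℝ)) x),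
    abs_mul (2 * K * ρ t x ^ (1 / 3 : ℝ)) (Torus.partialDeriv i (fun y => ρ t y ^ (1 / 3 : ℝ)) x),
    abs_of_pos (by positivity : (0:ℝ) < 3 * (ρ t x ^ (1 / 3 : ℝ)) ^ 2),
    abs_of_pos (by positivity : (0:ℝ) < 2 * K * ρ t x ^ (1 / 3 : ℝ))]
  exact ⟨mul_le_mul_of_nonneg_left hTI (by positivity), mul_le_mul_of_nonneg_left hTI (by positivity)⟩

end Summit.AtomisticToContinuum.HydrodynamicLimit.Theorems

end
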